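import Literature.NumberTheory.LFunctions.Zhang2022.KnifeEdgeEllThinBDH

/-!
# §D edge ell — where the `∀κ` forms of (14.8) at free scales are VACUOUSLY TRUE: the print-literal E-016 for
# `A ≤ 3` (empty `h`-range; critic ls-knife-crit-2 g4, F-ℓ14), and both E-016 / E-016′ when the large-conductor
# range `D³ ≤ r < 2DP₄` is empty (`A − 2B < 2`, eventually)

Y. Zhang, *Discrete mean estimates and the Landau–Siegel zero*, arXiv:2211.02515v1 [Zhang2022LandauSiegel] — an
unrefereed manuscript under adjudication. **WHAT THIS IS NOT: not a claim about Theorems 1–2 of arXiv:2211.02515, about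
Landau–Siegel zeros, about Parity, or about a repaired `Margin232`; nothing here proves or refutes E-016/E-016′ where they
have content (the B-ell window `A ∈ [920, 1590]`, `B < ½`). The theorems below only locate the parameter region where the
typed `Prop`s `KnifeEdge.Eq148DUniformUncond` / `Eq148DUniformFaithfulUncond` are TRIVIALLY true because a summation
range is empty — kernel bookkeeping for the card `prime-discharge-thin-bdh`'s refutation rung P2 («¬`Eq148DUniformUncond A B`
for every `A > 0`, `B < ½`»), which therefore cannot hold as worded for `A ≤ 3` (resp. `A − 2B < 2`) and must be read on the
window. The programme SEARCHES and TYPES; no claim about Landau–Siegel zeros, Theorems 1–2 of arXiv:2211.02515 or a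
repaired Margin232 until a kernel theorem says so.** (LANDAU–SIEGEL programme F-S3, cell `landau-siegel`, §D edge ell;
typer ls-knife-typer-2 g4; Part 1 adapted from the critic's scratch `HOME/ls-knife-crit-2/f14/Eq148VacuousLowA.lean`
(ls-knife-crit-2 g4, 2026-08-27T03:27Z, «offered to ls-knife-typer-2»).)

## What is here (theorems only)

* Part 1 (critic's F-ℓ14) — `hCutoff_empty_of_A_le_three`: for `A ≤ 3`, `D ≥ 1` and `r` in the large-conductor range
  (`r ≥ D³ ≥ D^A = P`) the print-literal cutoff `⌈P/r⌉ ≤ 1`, so the `h`-range `[1, ⌈P/r⌉)` is empty;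
  `rhs1417OnAt_eq_zero_of_A_le_three`; **`eq148DUniformUncond_of_A_le_three : A ≤ 3 → Eq148DUniformUncond A B`** (every `B`),
  hence also the ⟨A⟩-guarded `Eq148DUniform A B`.
* Part 2 — the large-conductor range itself: `largeConductorRange_eq_empty` (`⌈2D·P₄⌉ ≤ D³ ⇒` range `= ∅`), whence
  `u017MajorantAt_eq_zero_of_range_empty` (ANY cutoff, so both the truncated and the FAITHFUL majorant vanish) and the
  pointwise trivialities; and the eventual form **`largeConductorRange_eventually_empty : A − 2·B < 2 → ∀ᶠ D, range = ∅`**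
  (`2D·P₄ = 2D^{1+A−2B}𝓛⁵¹⁹ < D³` for large `D`), so **`eq148DUniformFaithfulUncond_of_lt_two`** and
  **`eq148DUniformUncond_of_lt_two`**: for `A − 2B < 2` both `∀κ` forms hold trivially (every `Bτ`, with `c = C = 1`).
  On the B-ell window (`A ≥ 920`, `B < ½`) neither vacuity applies: there `A − 2B > 2` and `A > 3`.

References: Zhang, arXiv:2211.02515v1, §14 (14.8) p.79 (the range `D³ ≤ r < 2DP₄`, tex L3962–L3963)
[cite: Zhang2022LandauSiegel, §14 (14.8) p.79].
-/

noncomputable section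

open Complex Real Filter

namespace Literature.NumberTheory.LFunctions.Zhang2022.KnifeEdge

open Skeleton EllScales Typed.Sec14

/-! ## Part 1 — the print-literal cutoff is empty for `A ≤ 3` (critic ls-knife-crit-2 g4, F-ℓ14) -/

/-- On the large-conductor range the print-literal `h`-cutoff `[1, ⌈P/r⌉)` is EMPTY when `A ≤ 3` (`D ≥ 1`): `r ≥ D³ ≥ D^A = P`.
(Adapted from ls-knife-crit-2 g4's scratch `Eq148VacuousLowA.hRange_empty`.) [cite: Zhang2022LandauSiegel, §14 (14.8) p.79] -/
theorem hCutoff_empty_of_A_le_three {A B : ℝ} (hA : A ≤ 3) {D : ℕ} (hD : 1 ≤ D) {r : ℕ}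
    (hr : r ∈ largeConductorRange (scalesAt A B D) D) :
    Finset.Ico 1 ⌈(scalesAt A B D).P / r⌉₊ = ∅ := by
  rw [largeConductorRange, Finset.mem_filter] at hr
  obtain ⟨-, hr3⟩ := hr
  replace hr3 : D ^ 3 ≤ r := not_lt.mp hr3
  have hD1 : (1 : ℝ) ≤ D := by exact_mod_cast hD
  have hr0 : (0 : ℝ) < r := by
    have : (1 : ℕ) ≤ r := le_trans (Nat.one_le_pow 3 D hD) hr3
    exact_mod_cast this
  have hP : (scalesAt A B D).P ≤ (r : ℝ) := by
    rw [scalesAt_P]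
    have h1 : Real.exp (A * Real.log D) ≤ Real.exp (3 * Real.log D) :=
      Real.exp_le_exp.mpr (mul_le_mul_of_nonneg_right hA (Real.log_nonneg hD1))
    have h2 : Real.exp (3 * Real.log D) = (D : ℝ) ^ 3 := by
      rw [← Real.rpow_natCast, Real.rpow_def_of_pos (by linarith)]
      norm_num [mul_comm]
    have h3 : ((D ^ 3 : ℕ) : ℝ) ≤ r := by exact_mod_cast hr3
    calc Real.exp (A * Real.log D) ≤ (D : ℝ) ^ 3 := h2 ▸ h1
      _ = ((D ^ 3 : ℕ) : ℝ) := by push_cast; ring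
      _ ≤ r := h3
  have hceil : ⌈(scalesAt A B D).P / r⌉₊ ≤ 1 := by
    apply Nat.ceil_le.mpr
    rw [Nat.cast_one, div_le_one hr0]
    exact hP
  exact Finset.Ico_eq_empty_of_le hceil

/-- Hence the print-literal majorant VANISHES on the large-conductor range for `A ≤ 3` (`D ≥ 1`).
(ls-knife-crit-2 g4's `rhs1417OnAt_eq_zero`.) [cite: Zhang2022LandauSiegel, §14 (14.8) p.79] -/
theorem rhs1417OnAt_eq_zero_of_A_le_three {A B : ℝ} (hA : A ≤ 3) {D : ℕ} [NeZero D] (hD : 1 ≤ D)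
    (χ : DirichletCharacter ℂ D) (κs : ℕ → ℂ) :
    rhs1417OnAt χ (scalesAt A B D) κs (largeConductorRange (scalesAt A B D) D) = 0 := by
  unfold rhs1417OnAt
  refine Finset.sum_eq_zero fun d _ => ?_
  rw [mul_eq_zero]; right
  refine Finset.sum_eq_zero fun r hr => ?_
  rw [hCutoff_empty_of_A_le_three hA hD hr]
  simp

/-- **F-ℓ14 (critic ls-knife-crit-2 g4): the print-literal priced form `Eq148DUniformUncond A B` is TRIVIALLY TRUE for every
`A ≤ 3` and every `B`** (empty `h`-range) — so the card `prime-discharge-thin-bdh`'s P2 «¬`Eq148DUniformUncond A B` for every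
`A > 0`, `B < ½`» is false as worded below `A = 3`; its content lives on the window (`A ≥ 920`), or on the faithful form.
[cite: Zhang2022LandauSiegel, §14 (14.8) p.79] -/
theorem eq148DUniformUncond_of_A_le_three {A : ℝ} (hA : A ≤ 3) (B : ℝ) : Eq148DUniformUncond A B := by
  intro Bτ
  refine ⟨1, one_pos, 1, 1, fun D _ χ hD _ _ κs as _ _ => ?_⟩
  rw [rhs1417OnAt_eq_zero_of_A_le_three hA hD]
  positivity

/-- … hence also the ⟨A⟩-guarded `Eq148DUniform A B` for `A ≤ 3`. [cite: Zhang2022LandauSiegel, §14 (14.8) p.79] -/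
theorem eq148DUniform_of_A_le_three {A : ℝ} (hA : A ≤ 3) (B : ℝ) : Eq148DUniform A B :=
  eq148DUniform_of_uncond (eq148DUniformUncond_of_A_le_three hA B)

/-! ## Part 2 — the large-conductor range `D³ ≤ r < 2DP₄` is EMPTY when `⌈2D·P₄⌉ ≤ D³` (eventually, iff `A − 2B < 2`) -/

/-- If `⌈2D·P₄⌉ ≤ D³` the large-conductor range `{D³ ≤ r < 2DP₄}` is empty. [cite: Zhang2022LandauSiegel, §14 (14.8) p.79] -/
theorem largeConductorRange_eq_empty (S : Scales) {D : ℕ} (h : ⌈2 * (D : ℝ) * S.P4⌉₊ ≤ D ^ 3) :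
    largeConductorRange S D = ∅ := by
  unfold largeConductorRange
  refine Finset.filter_eq_empty_iff.mpr fun r hr => ?_
  rw [Finset.mem_Ico] at hr
  exact not_not_intro (lt_of_lt_of_le hr.2 h)

variable {D : ℕ} [NeZero D] (χ : DirichletCharacter ℂ D)

omit [NeZero D] in
/-- On an empty `r`-range the u017 majorant vanishes for ANY cutoff (truncated or faithful).
[cite: Zhang2022LandauSiegel, §14 (14.8) p.79] -/
theorem u017MajorantAt_empty (S : Scales) (κs : ℕ → ℂ) (H : ℕ → ℕ) : u017MajorantAt χ S κs ∅ H = 0 := by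
  unfold u017MajorantAt
  simp

/-- **Eventual emptiness of the range**: if `A − 2B < 2` then for all large `D` the large-conductor range at
`scalesAt A B D` is empty (`2D·P₄ = 2·D^{1+A−2B}·𝓛⁵¹⁹ ≤ D³ − 1`, the polylog absorbed by `D^{2−(A−2B)}`).
[cite: Zhang2022LandauSiegel, §14 (14.8) p.79] -/
theorem largeConductorRange_eventually_empty {A B : ℝ} (hAB : A - 2 * B < 2) :
    ∀ᶠ D : ℕ in atTop, largeConductorRange (scalesAt A B D) D = ∅ := by
  have hε0 : 0 < 2 - (A - 2 * B) := by linarith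
  -- `(log x)^519 = o(x^{2−(A−2B)})`: eventually `4 (log x)^519 ≤ x^{2−(A−2B)}`
  have hlo := isLittleO_log_rpow_rpow_atTop (519 : ℝ) hε0
  have hev : ∀ᶠ x : ℝ in atTop, 4 * Real.log x ^ (519 : ℝ) ≤ x ^ (2 - (A - 2 * B)) := by
    filter_upwards [hlo.def (by norm_num : (0:ℝ) < 1 / 4), eventually_ge_atTop (1:ℝ)] with x hx hx1
    have hlog : 0 ≤ Real.log x := Real.log_nonneg hx1
    rw [Real.norm_of_nonneg (Real.rpow_nonneg hlog _),
      Real.norm_of_nonneg (Real.rpow_nonneg (zero_le_one.trans hx1) _)] at hx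
    linarith
  filter_upwards [tendsto_natCast_atTop_atTop.eventually hev, eventually_ge_atTop 2] with D hD hD2
  have hD0 : 0 < D := by omega
  have hDr : (0 : ℝ) < D := Nat.cast_pos.mpr hD0
  have hD2r : (2 : ℝ) ≤ D := by exact_mod_cast hD2
  have hlog : 0 ≤ Real.log D := Real.log_nonneg (by linarith)
  apply largeConductorRange_eq_empty
  -- `2·D·P₄ ≤ D³ − 1`, so `⌈2·D·P₄⌉ ≤ D³`
  have hP4 : (scalesAt A B D).P4 = (D : ℝ) ^ (A - 2 * B) * Real.log D ^ 519 := by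
    show Real.exp (A * Real.log D) / Real.exp (B * Real.log D) ^ 2 * Real.log D ^ 519 = _
    rw [Real.rpow_def_of_pos hDr, ← Real.exp_nat_mul, ← Real.exp_sub]
    congr 1; push_cast; ring_nf
  have hlogpow : Real.log D ^ 519 = Real.log D ^ (519 : ℝ) := by
    rw [← Real.rpow_natCast]; norm_num
  have hmain : 2 * (D : ℝ) * (scalesAt A B D).P4 ≤ (D : ℝ) ^ 3 - 1 := by
    rw [hP4, hlogpow]
    have h1 : 2 * (D : ℝ) * ((D : ℝ) ^ (A - 2 * B) * Real.log D ^ (519 : ℝ))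
        = (D : ℝ) ^ (1 + (A - 2 * B)) * (2 * Real.log D ^ (519 : ℝ)) := by
      rw [Real.rpow_add hDr, Real.rpow_one]; ring
    have h2 : (D : ℝ) ^ (1 + (A - 2 * B)) * (D : ℝ) ^ (2 - (A - 2 * B)) = (D : ℝ) ^ 3 := by
      rw [← Real.rpow_add hDr, ← Real.rpow_natCast]; norm_num
    have hpos : 0 ≤ (D : ℝ) ^ (1 + (A - 2 * B)) := Real.rpow_nonneg hDr.le _
    have h3 : (D : ℝ) ^ (1 + (A - 2 * B)) * (2 * Real.log D ^ (519 : ℝ))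
        ≤ (D : ℝ) ^ (1 + (A - 2 * B)) * ((D : ℝ) ^ (2 - (A - 2 * B)) / 2) :=
      mul_le_mul_of_nonneg_left (by linarith) hpos
    have h4 : (1 : ℝ) ≤ (D : ℝ) ^ 3 / 2 := by
      have h8 : (2 : ℝ) ^ 3 ≤ (D : ℝ) ^ 3 := pow_le_pow_left₀ (by norm_num) hD2r 3
      rw [le_div_iff₀ (by norm_num : (0:ℝ) < 2)]
      norm_num at h8
      linarith
    calc 2 * (D : ℝ) * ((D : ℝ) ^ (A - 2 * B) * Real.log D ^ (519 : ℝ))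
        = (D : ℝ) ^ (1 + (A - 2 * B)) * (2 * Real.log D ^ (519 : ℝ)) := h1
      _ ≤ (D : ℝ) ^ (1 + (A - 2 * B)) * ((D : ℝ) ^ (2 - (A - 2 * B)) / 2) := h3
      _ = (D : ℝ) ^ 3 / 2 := by rw [← mul_div_assoc, h2]
      _ ≤ (D : ℝ) ^ 3 - 1 := by linarith
  have hceil : (⌈2 * (D : ℝ) * (scalesAt A B D).P4⌉₊ : ℝ) < (D : ℝ) ^ 3 := by
    have hP4nn : 0 ≤ (scalesAt A B D).P4 := by
      rw [hP4]; exact mul_nonneg (Real.rpow_nonneg hDr.le _) (pow_nonneg hlog _)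
    have := Nat.ceil_lt_add_one (show 0 ≤ 2 * (D : ℝ) * (scalesAt A B D).P4 by positivity)
    linarith
  exact_mod_cast hceil.le

/-- For `A − 2B < 2`, eventually the FAITHFUL majorant on the large-conductor range is `0` (empty range).
[cite: Zhang2022LandauSiegel, §14 (14.8) p.79] -/
theorem rhs148FaithfulAt_eventually_zero {A B : ℝ} (hAB : A - 2 * B < 2) :
    ∀ᶠ D : ℕ in atTop, ∀ [NeZero D] (χ : DirichletCharacter ℂ D) (κs : ℕ → ℂ),
      rhs148FaithfulAt χ (scalesAt A B D) κs (largeConductorRange (scalesAt A B D) D) = 0 := by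
  filter_upwards [largeConductorRange_eventually_empty hAB] with D hD
  intro _ χ κs
  rw [hD, rhs148FaithfulAt, u017MajorantAt_empty]

/-- **Both `∀κ` forms are TRIVIALLY TRUE for `A − 2B < 2`** (empty range, eventually): the faithful priced form …
[cite: Zhang2022LandauSiegel, §14 (14.8) p.79] -/
theorem eq148DUniformFaithfulUncond_of_lt_two {A B : ℝ} (hAB : A - 2 * B < 2) : Eq148DUniformFaithfulUncond A B := by
  intro Bτ
  obtain ⟨D₀, hD₀⟩ := eventually_atTop.mp (largeConductorRange_eventually_empty hAB)
  refine ⟨1, one_pos, 1, D₀, fun D _ χ hD _ _ κs as _ _ => ?_⟩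
  rw [hD₀ D hD, rhs148FaithfulAt, u017MajorantAt_empty]
  positivity

/-- … and the print-literal priced form (so E-016's `∀κ` refutation, too, must be read with `A − 2B ≥ 2`).
[cite: Zhang2022LandauSiegel, §14 (14.8) p.79] -/
theorem eq148DUniformUncond_of_lt_two {A B : ℝ} (hAB : A - 2 * B < 2) : Eq148DUniformUncond A B := by
  intro Bτ
  obtain ⟨D₀, hD₀⟩ := eventually_atTop.mp (largeConductorRange_eventually_empty hAB)
  refine ⟨1, one_pos, 1, D₀, fun D _ χ hD _ _ κs as _ _ => ?_⟩
  rw [hD₀ D hD, rhs1417OnAt_eq_u017MajorantAt, u017MajorantAt_empty]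
  positivity

/-! ## Part 3 (v2 append) — the converse side: on the window the range is NOT empty and the faithful cutoff keeps `h = 1` -/

/-- **No range-vacuity on the window**: for `A − 2B ≥ 2` and `D ≥ 3` the modulus `r = D³` lies in the large-conductor
range at `scalesAt A B D` (`2D·P₄ = 2D^{1+A−2B}𝓛⁵¹⁹ ≥ 2D³ > D³`). [cite: Zhang2022LandauSiegel, §14 (14.8) p.79] -/
theorem cube_mem_largeConductorRange {A B : ℝ} (hAB : 2 ≤ A - 2 * B) {D : ℕ} (hD : 3 ≤ D) :
    D ^ 3 ∈ largeConductorRange (scalesAt A B D) D := by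
  have hD0 : 0 < D := by omega
  have hDr : (0 : ℝ) < D := Nat.cast_pos.mpr hD0
  have hD1 : (1 : ℝ) ≤ D := by exact_mod_cast (show 1 ≤ D by omega)
  have hD3 : (3 : ℝ) ≤ D := by exact_mod_cast hD
  have hlog : 1 ≤ Real.log D := by
    rw [← Real.log_exp 1]
    exact Real.log_le_log (Real.exp_pos 1) ((Real.exp_one_lt_d9.le.trans (by norm_num)).trans hD3)
  have hP4 : (scalesAt A B D).P4 = (D : ℝ) ^ (A - 2 * B) * Real.log D ^ 519 := by
    show Real.exp (A * Real.log D) / Real.exp (B * Real.log D) ^ 2 * Real.log D ^ 519 = _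
    rw [Real.rpow_def_of_pos hDr, ← Real.exp_nat_mul, ← Real.exp_sub]
    congr 1; push_cast; ring_nf
  -- `D³ < 2·D·P₄`
  have hbig : ((D ^ 3 : ℕ) : ℝ) < 2 * (D : ℝ) * (scalesAt A B D).P4 := by
    rw [hP4]
    have h1 : (D : ℝ) ^ (2 : ℝ) ≤ (D : ℝ) ^ (A - 2 * B) :=
      Real.rpow_le_rpow_of_exponent_le hD1 (by linarith)
    have h2 : (D : ℝ) ^ (2 : ℝ) = (D : ℝ) ^ 2 := by rw [← Real.rpow_natCast]; norm_num
    have h3 : (1 : ℝ) ≤ Real.log D ^ 519 := one_le_pow₀ hlog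
    have h4 : (D : ℝ) ^ 2 ≤ (D : ℝ) ^ (A - 2 * B) * Real.log D ^ 519 := by
      calc (D : ℝ) ^ 2 = (D : ℝ) ^ (2 : ℝ) * 1 := by rw [h2, mul_one]
        _ ≤ (D : ℝ) ^ (A - 2 * B) * Real.log D ^ 519 :=
            mul_le_mul h1 h3 zero_le_one (Real.rpow_nonneg hDr.le _)
    have h5 : ((D ^ 3 : ℕ) : ℝ) = (D : ℝ) * (D : ℝ) ^ 2 := by push_cast; ring
    rw [h5]
    nlinarith
  unfold largeConductorRange
  rw [Finset.mem_filter, Finset.mem_Ico]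
  refine ⟨⟨le_trans (by norm_num) (Nat.pow_le_pow_left (show 2 ≤ D by omega) 3), ?_⟩, lt_irrefl _⟩
  exact Nat.lt_ceil.mpr hbig

/-- **The faithful cutoff never empties on the range**: for `r` in the large-conductor range, `r < 2DP₄`, so
`⌈2DP₄/r⌉ ≥ 2` and `h = 1` passes the cutoff (the divisibility filter `D/(D,r) ∣ h` is a separate condition).
[cite: Zhang2022LandauSiegel, §14 (14.6)–(14.8) p.79] -/
theorem one_mem_Ico_faithfulCutoff (S : Scales) {D r : ℕ} (hr : r ∈ largeConductorRange S D) :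
    1 ∈ Finset.Ico 1 (faithfulCutoff S D r) := by
  unfold largeConductorRange at hr
  rw [Finset.mem_filter, Finset.mem_Ico] at hr
  obtain ⟨⟨hr2, hrlt⟩, -⟩ := hr
  have hr0 : (0 : ℝ) < r := by exact_mod_cast (show 0 < r by omega)
  have hx : (r : ℝ) < 2 * (D : ℝ) * S.P4 := Nat.lt_ceil.mp hrlt
  rw [Finset.mem_Ico]
  refine ⟨le_rfl, ?_⟩
  unfold faithfulCutoff
  refine Nat.lt_ceil.mpr ?_
  rw [Nat.cast_one, lt_div_iff₀ hr0, one_mul]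
  exact hx

end Literature.NumberTheory.LFunctions.Zhang2022.KnifeEdge
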